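import Literature.Geometry.Kaehler.TransversalPairChart
import Literature.Analysis.Complex.OsgoodProofs
import Literature.Analysis.Complex.HadamardDivision
import HarnessLib

/-!
# The ideal of a transversal pair on a chart set: statement

Layer `Literature/Geometry/Kaehler`. On a complex manifold `M` modelled on `E`, consider a chart set
`W = chartSet 𝓘(ℝ, E) x₀ C` (`C` open convex in the target of the chart at `x₀`) and two
holomorphic functions `t₁, t₂` on `W` with `dt₁ ≠ 0` along `{t₁ = 0}` and `(dt₁, dt₂)` jointly
surjective along `Z = {t₁ = t₂ = 0}`. When `dim E = 2` the pair `(t₁, t₂)` is then a system of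
holomorphic local coordinates at each point of `Z`, and the classical local algebra of a simple point
(E. M. Chirka, *Complex Analytic Sets* (1989), §2.8; R. C. Gunning, H. Rossi (1965), Ch. II §E:
`t₁, t₂` generate the maximal ideal of `𝒪_{M,z}`) globalises over the chart-convex `W` (Cartan's
Théorème B in its Cousin-I form, as in `HypersurfaceExtensionChart`): **a holomorphic function on `W`
vanishing on `Z` lies in the ideal `(t₁, t₂) 𝒪(W)`** (in every dimension `(t₁, t₂)` extend to local
coordinates along `Z` and generate the ideal of the submanifold `Z`). This file NAMES that property of
the pair `(E, M)` — `HasTransversalNullstellensatz E M` — as the hypothesis consumed by the dimension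
count of Serre's théorème A for line cocycles on a projective surface
(`HolomorphicLineBundle.TwistPencil.decompose`); the proof for `finrank ℂ E = 2` is appended to this
file.

## References

* E. M. Chirka, *Complex Analytic Sets* (1989), §2.8. [Chirka1989]
* K. Fritzsche, H. Grauert, *From Holomorphic Functions to Complex Manifolds* (2002), Ch. V §1, §3.
  [FritzscheGrauert2002]
-/

noncomputable section

open scoped Manifold ContDiff Topology
open Set Function

namespace Literature.Geometry.Kaehler

variable (E : Type*) [NormedAddCommGroup E] [NormedSpace ℂ E]
  (M : Type*) [TopologicalSpace M] [ChartedSpace E M]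

/-- **The transversal Nullstellensatz on chart sets of `M`**: for every chart set
`W = chartSet 𝓘(ℝ, E) x₀ C` (`C` open convex in the chart target), all holomorphic `t₁, t₂, f` on `W`
with `dt₁ ≠ 0` on `W ∩ {t₁ = 0}` and `(dt₁, dt₂)` onto `ℂ²` on `W ∩ {t₁ = t₂ = 0}`, if `f` vanishes
on `W ∩ {t₁ = t₂ = 0}` then `f = t₁ g + t₂ h` on `W` with `g, h` holomorphic on `W` — the equations
of a transversal complete intersection generate its ideal over a chart-convex set. Stated as a
PROPERTY of `(E, M)` (proved in the tree for `dim E = 2`, where `{t₁ = t₂ = 0}` is a discrete set of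
simple points and `(t₁, t₂)` are local coordinates there), isolated as the hypothesis of the surface
case of Serre's dimension count. [cite: Chirka1989, §2.8] -/
def HasTransversalNullstellensatz : Prop :=
  ∀ (x₀ : M) ⦃C : Set E⦄, IsOpen C → Convex ℝ C → C ⊆ (extChartAt 𝓘(ℝ, E) x₀).target →
    ∀ ⦃t₁ t₂ f : M → ℂ⦄,
      MDifferentiableOn 𝓘(ℂ, E) 𝓘(ℂ, ℂ) t₁ (chartSet 𝓘(ℝ, E) x₀ C) →
      MDifferentiableOn 𝓘(ℂ, E) 𝓘(ℂ, ℂ) t₂ (chartSet 𝓘(ℝ, E) x₀ C) →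
      MDifferentiableOn 𝓘(ℂ, E) 𝓘(ℂ, ℂ) f (chartSet 𝓘(ℝ, E) x₀ C) →
      (∀ x ∈ chartSet 𝓘(ℝ, E) x₀ C, t₁ x = 0 → mfderiv 𝓘(ℂ, E) 𝓘(ℂ, ℂ) t₁ x ≠ 0) →
      (∀ x ∈ chartSet 𝓘(ℝ, E) x₀ C, t₁ x = 0 → t₂ x = 0 →
        Surjective (ContinuousLinearMap.pi fun i : Fin 2 ↦
          (![mfderiv 𝓘(ℂ, E) 𝓘(ℂ, ℂ) t₁ x, mfderiv 𝓘(ℂ, E) 𝓘(ℂ, ℂ) t₂ x] i))) →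
      (∀ x ∈ chartSet 𝓘(ℝ, E) x₀ C, t₁ x = 0 → t₂ x = 0 → f x = 0) →
      ∃ g h : M → ℂ, MDifferentiableOn 𝓘(ℂ, E) 𝓘(ℂ, ℂ) g (chartSet 𝓘(ℝ, E) x₀ C) ∧
        MDifferentiableOn 𝓘(ℂ, E) 𝓘(ℂ, ℂ) h (chartSet 𝓘(ℝ, E) x₀ C) ∧
        ∀ x ∈ chartSet 𝓘(ℝ, E) x₀ C, f x = t₁ x * g x + t₂ x * h x


/-! ### The local algebra at a transversal zero in dimension two -/

section LocalAlgebra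

variable {E}
variable [FiniteDimensional ℂ E]

/-- **Hadamard at a simple point of a transversal pair, `dim E = 2`.** If `t₁, t₂, f` are
holomorphic on the open `Ω ∋ z`, `t₁ z = t₂ z = f z = 0` and `(dt₁(z), dt₂(z))` is onto `ℂ²`, then
near `z` one has `f = t₁ g + t₂ h` with `g, h` holomorphic: `Φ = (t₁, t₂)` is a local biholomorphism
at `z` (inverse function theorem, `Φ` being analytic by Osgood's lemma), and Hadamard's lemma on a
polydisc around `Φ z = 0` (`SCV.exists_eq_sum_smul_of_apply_eq_zero`) is pulled back along `Φ`.
[cite: Chirka1989, §2.8] -/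
theorem exists_nhds_eq_mul_add_mul_of_surjective (hE : Module.finrank ℂ E = 2) {Ω : Set E}
    (hΩ : IsOpen Ω) {t₁ t₂ f : E → ℂ} (ht₁ : DifferentiableOn ℂ t₁ Ω) (ht₂ : DifferentiableOn ℂ t₂ Ω)
    (hf : DifferentiableOn ℂ f Ω) {z : E} (hz : z ∈ Ω) (hz₁ : t₁ z = 0) (hz₂ : t₂ z = 0)
    (hfz : f z = 0)
    (hsurj : Surjective (ContinuousLinearMap.pi fun i : Fin 2 ↦
      (![fderiv ℂ t₁ z, fderiv ℂ t₂ z] i))) :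
    ∃ N : Set E, IsOpen N ∧ z ∈ N ∧ N ⊆ Ω ∧ ∃ g h : E → ℂ, DifferentiableOn ℂ g N ∧
      DifferentiableOn ℂ h N ∧ ∀ x ∈ N, f x = t₁ x * g x + t₂ x * h x := by
  haveI : CompleteSpace E := FiniteDimensional.complete ℂ E
  -- the map `Φ = (t₁, t₂)` and its derivative at `z`
  set T : Fin 2 → E → ℂ := ![t₁, t₂] with hT
  set Φ : E → (Fin 2 → ℂ) := fun x i ↦ T i x with hΦ
  have hT0 : T 0 = t₁ := rfl
  have hT1 : T 1 = t₂ := rfl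
  have hTd : ∀ i, DifferentiableOn ℂ (T i) Ω := fun i ↦ by
    fin_cases i
    · exact ht₁
    · exact ht₂
  have hΦd : DifferentiableOn ℂ Φ Ω := differentiableOn_pi.2 fun i ↦ hTd i
  have hΦan : AnalyticAt ℂ Φ z :=
    Literature.Analysis.Complex.SCV.analyticAt_of_differentiableOn hΦd hΩ hz
  set L : E →L[ℂ] (Fin 2 → ℂ) :=
    ContinuousLinearMap.pi fun i : Fin 2 ↦ (![fderiv ℂ t₁ z, fderiv ℂ t₂ z] i) with hL
  have hΦL : HasFDerivAt Φ L z := by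
    rw [hΦ, hL, hasFDerivAt_pi]
    intro i
    fin_cases i
    · exact (ht₁.differentiableAt (hΩ.mem_nhds hz)).hasFDerivAt
    · exact (ht₂.differentiableAt (hΩ.mem_nhds hz)).hasFDerivAt
  -- `L` is bijective (`dim E = 2`)
  have hdim : Module.finrank ℂ E = Module.finrank ℂ (Fin 2 → ℂ) := by
    rw [hE, Module.finrank_fin_fun]
  have hrange : L.range = ⊤ := LinearMap.range_eq_top.2 hsurj
  have hker : L.ker = ⊥ := (LinearMap.ker_eq_bot_iff_range_eq_top_of_finrank_eq_finrank hdim).2 hrange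
  set e : E ≃L[ℂ] (Fin 2 → ℂ) := ContinuousLinearEquiv.ofBijective L hker hrange with he
  have heL : (e : E →L[ℂ] (Fin 2 → ℂ)) = L := ContinuousLinearEquiv.coe_ofBijective L hker hrange
  have hΦe : HasFDerivAt Φ (e : E →L[ℂ] (Fin 2 → ℂ)) z := by rw [heL]; exact hΦL
  have hcd : ContDiffAt ℂ 1 Φ z := hΦan.contDiffAt
  -- the local inverse
  set P := hcd.toOpenPartialHomeomorph Φ hΦe one_ne_zero with hP
  set Ψ : (Fin 2 → ℂ) → E := hcd.localInverse hΦe one_ne_zero with hΨ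
  have hΨP : Ψ = P.symm := rfl
  have hPΦ : (P : E → (Fin 2 → ℂ)) = Φ := rfl
  have hzP : z ∈ P.source := hcd.mem_toOpenPartialHomeomorph_source hΦe one_ne_zero
  have hΦzP : Φ z ∈ P.target := hcd.image_mem_toOpenPartialHomeomorph_target hΦe one_ne_zero
  have hΨz : Ψ (Φ z) = z := hcd.localInverse_apply_image hΦe one_ne_zero
  have hΨ1 : ContDiffAt ℂ 1 Ψ (Φ z) := hcd.to_localInverse hΦe one_ne_zero
  have hΨev : ∀ᶠ y in 𝓝 (Φ z), ContDiffAt ℂ 1 Ψ y := hΨ1.eventually (by simp)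
  -- a good neighbourhood of `Φ z`: `Ψ` differentiable there, inside the target, mapped into `Ω`
  have hG₂ : IsOpen (P.target ∩ P.symm ⁻¹' Ω) :=
    P.continuousOn_symm.isOpen_inter_preimage P.open_target hΩ
  have hG₂z : Φ z ∈ P.target ∩ P.symm ⁻¹' Ω := ⟨hΦzP, by rw [mem_preimage, ← hΨP, hΨz]; exact hz⟩
  obtain ⟨r, hr, hball⟩ : ∃ r > 0, Metric.ball (Φ z) r ⊆
      {y | ContDiffAt ℂ 1 Ψ y} ∩ (P.target ∩ P.symm ⁻¹' Ω) :=
    Metric.mem_nhds_iff.1 (Filter.inter_mem hΨev (hG₂.mem_nhds hG₂z))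
  -- Hadamard on the polydisc of radius `r` around `Φ z`
  set B : Set (Fin 2 → ℂ) :=
    {w | ∀ i, ContinuousLinearMap.proj (R := ℂ) i (w - Φ z) ∈ Metric.ball (0 : ℂ) r} with hB
  have hBball : B ⊆ Metric.ball (Φ z) r := fun w hw ↦ by
    rw [Metric.mem_ball, dist_pi_lt_iff hr]
    intro i
    have h := hw i
    rw [ContinuousLinearMap.proj_apply, Pi.sub_apply, Metric.mem_ball, dist_zero_right] at h
    rwa [dist_eq_norm]
  have hballB : Metric.ball (Φ z) r ⊆ B := fun w hw i ↦ by
    rw [Metric.mem_ball, dist_pi_lt_iff hr] at hw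
    rw [ContinuousLinearMap.proj_apply, Pi.sub_apply, Metric.mem_ball, dist_zero_right,
      ← dist_eq_norm]
    exact hw i
  have hBo : IsOpen B := by
    rw [subset_antisymm hBball hballB]
    exact Metric.isOpen_ball
  have hF : DifferentiableOn ℂ (f ∘ Ψ) B := fun w hw ↦ by
    have hw' := hball (hBball hw)
    have h0 : ContDiffAt ℂ 1 Ψ w := hw'.1
    have h1 : DifferentiableAt ℂ Ψ w := h0.differentiableAt one_ne_zero
    have h2 : DifferentiableAt ℂ f (Ψ w) := hf.differentiableAt (hΩ.mem_nhds hw'.2.2)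
    exact (h2.comp w h1).differentiableWithinAt
  have hFa : (f ∘ Ψ) (Φ z) = 0 := by rw [Function.comp_apply, hΨz, hfz]
  have hdual : ∀ i j : Fin 2, ContinuousLinearMap.proj (R := ℂ) i (Pi.single j (1 : ℂ) : Fin 2 → ℂ) =
      if i = j then 1 else 0 := fun i j ↦ by
    rw [ContinuousLinearMap.proj_apply, Pi.single_apply]
  have hspan : ∀ w : Fin 2 → ℂ, ∑ i, ContinuousLinearMap.proj (R := ℂ) i w • (Pi.single i (1 : ℂ) :
      Fin 2 → ℂ) = w := fun w ↦ by
    funext j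
    simp only [Finset.sum_apply, Pi.smul_apply, ContinuousLinearMap.proj_apply, Pi.single_apply,
      smul_eq_mul, mul_ite, mul_one, mul_zero, Finset.sum_ite_eq, Finset.mem_univ, if_true]
  obtain ⟨G, hG, hFG⟩ := Literature.Analysis.Complex.SCV.exists_eq_sum_smul_of_apply_eq_zero
    (fun i : Fin 2 ↦ (Pi.single i (1 : ℂ) : Fin 2 → ℂ)) (fun i ↦ ContinuousLinearMap.proj (R := ℂ) i)
    hdual hspan (Φ z) (fun _ ↦ Metric.ball (0 : ℂ) r) (fun _ ↦ Metric.isOpen_ball)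
    (fun _ ↦ Metric.mem_ball_self hr) hF hFa
  -- pull back along `Φ`
  set N : Set E := Ω ∩ Φ ⁻¹' Metric.ball (Φ z) r ∩ P.source with hN
  have hNo : IsOpen N :=
    (hΦd.continuousOn.isOpen_inter_preimage hΩ Metric.isOpen_ball).inter P.open_source
  have hzN : z ∈ N := ⟨⟨hz, Metric.mem_ball_self hr⟩, hzP⟩
  have hNΩ : N ⊆ Ω := fun x hx ↦ hx.1.1
  have hNB : ∀ x ∈ N, Φ x ∈ B := fun x hx ↦ hballB hx.1.2
  have hGΦ : ∀ i, DifferentiableOn ℂ (fun x ↦ G i (Φ x)) N := fun i x hx ↦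
    (((hG i).differentiableAt (hBo.mem_nhds (hNB x hx))).comp x
      (hΦd.differentiableAt (hΩ.mem_nhds (hNΩ hx)))).differentiableWithinAt
  refine ⟨N, hNo, hzN, hNΩ, fun x ↦ G 0 (Φ x), fun x ↦ G 1 (Φ x), hGΦ 0, hGΦ 1, fun x hx ↦ ?_⟩
  have hΨΦ : Ψ (Φ x) = x := by rw [hΨP, ← hPΦ]; exact P.left_inv hx.2
  have h1 := hFG (Φ x) (hNB x hx)
  rw [Function.comp_apply, hΨΦ, Fin.sum_univ_two] at h1
  simp only [ContinuousLinearMap.proj_apply, Pi.sub_apply, smul_eq_mul] at h1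
  have e0 : Φ x 0 = t₁ x := rfl
  have e1 : Φ x 1 = t₂ x := rfl
  have ez0 : Φ z 0 = 0 := hz₁
  have ez1 : Φ z 1 = 0 := hz₂
  rw [e0, e1, ez0, ez1, sub_zero, sub_zero] at h1
  exact h1

/-- **The transversal Nullstellensatz on a convex open set, `dim E = 2`**: if `t₁, t₂, f` are
holomorphic on the convex open `Ω`, `dt₁ ≠ 0` along `{t₁ = 0}`, `(dt₁, dt₂)` is onto `ℂ²` along
`Z = {t₁ = t₂ = 0}` and `f` vanishes on `Z`, then `f = t₁ g + t₂ h` on `Ω` with `g, h` holomorphic.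
Proof: the function `u = f/t₂` on `Y = {t₁ = 0}` — completed at the points of `Z` by the local
Hadamard coefficient, well defined by the uniqueness of the quotient (`(t₁, t₂)` is a regular pair,
`SCV.exists_eq_smul_of_mul_eq_mul`) — is locally the restriction of holomorphic functions, hence
(`exists_differentiableOn_forall_eq_of_local`, Cousin I on the convex `Ω`) the restriction of ONE
holomorphic `h` on `Ω`; then `f - t₂ h` vanishes on `Y` and is `t₁ g` by division
(`SCV.exists_eq_smul_of_eqOn_zero`). [cite: Chirka1989, §2.8] -/
theorem exists_eq_mul_add_mul_of_forall_eq_zero (hE : Module.finrank ℂ E = 2) {Ω : Set E}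
    (hΩo : IsOpen Ω) (hΩc : Convex ℝ Ω) {t₁ t₂ f : E → ℂ} (ht₁ : DifferentiableOn ℂ t₁ Ω)
    (ht₂ : DifferentiableOn ℂ t₂ Ω) (hf : DifferentiableOn ℂ f Ω)
    (hd₁ : ∀ x ∈ Ω, t₁ x = 0 → fderiv ℂ t₁ x ≠ 0)
    (hd₁₂ : ∀ x ∈ Ω, t₁ x = 0 → t₂ x = 0 →
      Surjective (ContinuousLinearMap.pi fun i : Fin 2 ↦ (![fderiv ℂ t₁ x, fderiv ℂ t₂ x] i)))
    (hfZ : ∀ x ∈ Ω, t₁ x = 0 → t₂ x = 0 → f x = 0) :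
    ∃ g h : E → ℂ, DifferentiableOn ℂ g Ω ∧ DifferentiableOn ℂ h Ω ∧
      ∀ x ∈ Ω, f x = t₁ x * g x + t₂ x * h x := by
  classical
  have hind : ∀ x ∈ Ω, t₁ x = 0 → t₂ x = 0 → ∀ c : ℂ, fderiv ℂ t₂ x ≠ c • fderiv ℂ t₁ x :=
    fun x hx h1 h2 c hc ↦ not_surjective_pi_of_eq_smul hc (hd₁₂ x hx h1 h2)
  -- local decompositions at the points of `Z`
  have hloc : ∀ (z : E) (hz : z ∈ Ω ∧ t₁ z = 0 ∧ t₂ z = 0), ∃ N : Set E, IsOpen N ∧ z ∈ N ∧ N ⊆ Ω ∧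
      ∃ g h : E → ℂ, DifferentiableOn ℂ g N ∧ DifferentiableOn ℂ h N ∧
        ∀ x ∈ N, f x = t₁ x * g x + t₂ x * h x := fun z hz ↦
    exists_nhds_eq_mul_add_mul_of_surjective hE hΩo ht₁ ht₂ hf hz.1 hz.2.1 hz.2.2
      (hfZ z hz.1 hz.2.1 hz.2.2) (hd₁₂ z hz.1 hz.2.1 hz.2.2)
  choose N hNo hzN hNΩ g h hg hh hfgh using hloc
  -- the function `u = f / t₂` on `Y`, completed at `Z`
  let u : E → ℂ := fun y ↦
    if hy : y ∈ Ω ∧ t₁ y = 0 ∧ t₂ y = 0 then h y hy y else f y * (t₂ y)⁻¹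
  -- on `N z ∩ Y` it is the Hadamard coefficient `h z`
  have hu : ∀ (z : E) (hz : z ∈ Ω ∧ t₁ z = 0 ∧ t₂ z = 0), ∀ y ∈ N z hz, t₁ y = 0 →
      u y = h z hz y := by
    intro z hz y hy hy1
    by_cases hy2 : t₂ y = 0
    · have hy' : y ∈ Ω ∧ t₁ y = 0 ∧ t₂ y = 0 := ⟨hNΩ z hz hy, hy1, hy2⟩
      have huy : u y = h y hy' y := dif_pos hy'
      rw [huy]
      -- uniqueness of the coefficient at a point of `Z`: compare on `N z ∩ N y`
      set O : Set E := N z hz ∩ N y hy' with hO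
      have hOo : IsOpen O := (hNo z hz).inter (hNo y hy')
      have hOΩ : O ⊆ Ω := inter_subset_left.trans (hNΩ z hz)
      obtain ⟨k, -, hk⟩ := Literature.Analysis.Complex.SCV.exists_eq_smul_of_mul_eq_mul hOo
        (ht₁.mono hOΩ) (ht₂.mono hOΩ)
        (((hh y hy').mono inter_subset_right).sub ((hh z hz).mono inter_subset_left))
        (fun x hx ↦ hd₁ x (hOΩ hx)) (fun x hx ↦ hind x (hOΩ hx))
        (g := fun x ↦ g z hz x - g y hy' x) (fun x hx ↦ by
          have e1 := hfgh z hz x hx.1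
          have e2 := hfgh y hy' x hx.2
          simp only [smul_eq_mul, Pi.sub_apply]
          linear_combination e1 - e2)
      have hy0 := hk y ⟨hy, hzN y hy'⟩
      rw [Pi.sub_apply, hy1, zero_smul, sub_eq_zero] at hy0
      exact hy0
    · have hy' : ¬ (y ∈ Ω ∧ t₁ y = 0 ∧ t₂ y = 0) := fun h' ↦ hy2 h'.2.2
      have huy : u y = f y * (t₂ y)⁻¹ := dif_neg hy'
      have e1 := hfgh z hz y hy
      rw [hy1, zero_mul, zero_add] at e1
      rw [huy, e1, mul_comm (t₂ y), mul_inv_cancel_right₀ hy2]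
  -- `u` is locally on `Y` the restriction of holomorphic functions
  have hlocal : ∀ y ∈ Ω, t₁ y = 0 → ∃ N' : Set E, IsOpen N' ∧ y ∈ N' ∧ N' ⊆ Ω ∧
      ∃ F : E → ℂ, DifferentiableOn ℂ F N' ∧ ∀ x ∈ N', t₁ x = 0 → F x = u x := by
    intro y hy hy1
    by_cases hy2 : t₂ y = 0
    · have hy' : y ∈ Ω ∧ t₁ y = 0 ∧ t₂ y = 0 := ⟨hy, hy1, hy2⟩
      exact ⟨N y hy', hNo y hy', hzN y hy', hNΩ y hy', h y hy', hh y hy', fun x hx hx1 ↦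
        (hu y hy' x hx hx1).symm⟩
    · refine ⟨Ω ∩ t₂ ⁻¹' {0}ᶜ, ht₂.continuousOn.isOpen_inter_preimage hΩo isOpen_compl_singleton,
        ⟨hy, hy2⟩, inter_subset_left, fun x ↦ f x * (t₂ x)⁻¹,
        fun x hx ↦ ((hf.differentiableAt (hΩo.mem_nhds hx.1)).mul
          ((ht₂.differentiableAt (hΩo.mem_nhds hx.1)).inv hx.2)).differentiableWithinAt,
        fun x hx _ ↦ ?_⟩
      have hx' : ¬ (x ∈ Ω ∧ t₁ x = 0 ∧ t₂ x = 0) := fun h' ↦ hx.2 h'.2.2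
      have hux : u x = f x * (t₂ x)⁻¹ := dif_neg hx'
      exact hux.symm
  -- extension from the hypersurface `Y = {t₁ = 0}`
  obtain ⟨Hf, hHf, hHfu⟩ := exists_differentiableOn_forall_eq_of_local hΩo hΩc ht₁ hd₁ hlocal
  -- `f - t₂ Hf` vanishes on `Y`, hence is divisible by `t₁`
  have hvan : ∀ x ∈ Ω, t₁ x = 0 → (f - t₂ * Hf) x = 0 := by
    intro x hx hx1
    rw [Pi.sub_apply, Pi.mul_apply, hHfu x hx hx1]
    by_cases hx2 : t₂ x = 0
    · rw [hfZ x hx hx1 hx2, hx2, zero_mul, sub_zero]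
    · have hx' : ¬ (x ∈ Ω ∧ t₁ x = 0 ∧ t₂ x = 0) := fun h' ↦ hx2 h'.2.2
      have hux : u x = f x * (t₂ x)⁻¹ := dif_neg hx'
      rw [hux, mul_comm (f x), ← mul_assoc, mul_inv_cancel₀ hx2, one_mul, sub_self]
  obtain ⟨G, hG, hfG⟩ := Literature.Analysis.Complex.SCV.exists_eq_smul_of_eqOn_zero hΩo ht₁
    (hf.sub (ht₂.mul hHf)) hd₁ hvan
  refine ⟨G, Hf, hG, hHf, fun x hx ↦ ?_⟩
  have h1 := hfG x hx
  rw [Pi.sub_apply, Pi.mul_apply, smul_eq_mul] at h1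
  linear_combination h1

end LocalAlgebra

/-! ### Transport to the chart sets of a complex surface -/

variable {E M}
variable [FiniteDimensional ℂ E] [IsManifold 𝓘(ℂ, E) ω M]

/-- **Complex surfaces have the transversal Nullstellensatz on chart sets**: for `dim E = 2`,
`HasTransversalNullstellensatz E M` holds (the convex-domain statement
`exists_eq_mul_add_mul_of_forall_eq_zero` read in the holomorphic chart at `x₀`, the differential
conditions being transported by `mfderiv_eq_fderiv_comp_symm_comp` with the invertible differential
of the chart). [cite: Chirka1989, §2.8] -/
theorem hasTransversalNullstellensatz_of_finrank_eq_two (hE : Module.finrank ℂ E = 2) :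
    HasTransversalNullstellensatz E M := by
  intro x₀ C hCo hCc hCT t₁ t₂ f ht₁ ht₂ hf hd₁ hd₁₂ hfZ
  set φ := extChartAt 𝓘(ℂ, E) x₀ with hφ
  set W := chartSet 𝓘(ℝ, E) x₀ C with hW
  have hWo : IsOpen W := isOpen_chartSet 𝓘(ℝ, E) x₀ hCo
  have hWs : W ⊆ φ.source := chartSet_subset_source 𝓘(ℝ, E) x₀ C
  have hφW : ∀ x ∈ W, φ x ∈ C := fun x hx ↦ (mem_chartSet_iff.1 hx).2
  have hsymm : ∀ y ∈ C, φ.symm y ∈ W := fun y hy ↦ symm_mem_chartSet hCT hy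
  -- the data read in the chart
  have hrd : ∀ {v : M → ℂ}, MDifferentiableOn 𝓘(ℂ, E) 𝓘(ℂ, ℂ) v W →
      DifferentiableOn ℂ (v ∘ φ.symm) C := fun hv ↦
    (differentiableOn_comp_extChartAt_symm_of_mdifferentiableOn hv hWo x₀).mono
      fun y hy ↦ ⟨hCT hy, hsymm y hy⟩
  have hts : ∀ {v : M → ℂ}, MDifferentiableOn 𝓘(ℂ, E) 𝓘(ℂ, ℂ) v W → ∀ y ∈ C,
      DifferentiableAt ℂ (v ∘ φ.symm) (φ (φ.symm y)) := fun hv y hy ↦ by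
    rw [φ.right_inv (hCT hy)]
    exact (hrd hv).differentiableAt (hCo.mem_nhds hy)
  have hd₁' : ∀ y ∈ C, (t₁ ∘ φ.symm) y = 0 → fderiv ℂ (t₁ ∘ φ.symm) y ≠ 0 := fun y hy hty h0 ↦ by
    have hx : φ.symm y ∈ W := hsymm y hy
    refine hd₁ _ hx hty ((mfderiv_eq_zero_iff_fderiv_comp_symm_eq_zero x₀ (hWs hx)
      (hts ht₁ y hy)).2 ?_)
    rw [φ.right_inv (hCT hy)]
    exact h0
  have hd₁₂' : ∀ y ∈ C, (t₁ ∘ φ.symm) y = 0 → (t₂ ∘ φ.symm) y = 0 →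
      Surjective (ContinuousLinearMap.pi fun i : Fin 2 ↦
        (![fderiv ℂ (t₁ ∘ φ.symm) y, fderiv ℂ (t₂ ∘ φ.symm) y] i)) := by
    intro y hy h1y h2y
    have hx : φ.symm y ∈ W := hsymm y hy
    have hxs : φ.symm y ∈ φ.source := hWs hx
    have hy' : φ (φ.symm y) = y := φ.right_inv (hCT hy)
    have hs := hd₁₂ _ hx h1y h2y
    have e₁ := mfderiv_eq_fderiv_comp_symm_comp x₀ hxs (hts ht₁ y hy)
    have e₂ := mfderiv_eq_fderiv_comp_symm_comp x₀ hxs (hts ht₂ y hy)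
    rw [hy'] at e₁ e₂
    have epi : (ContinuousLinearMap.pi fun i : Fin 2 ↦
        (![mfderiv 𝓘(ℂ, E) 𝓘(ℂ, ℂ) t₁ (φ.symm y), mfderiv 𝓘(ℂ, E) 𝓘(ℂ, ℂ) t₂ (φ.symm y)] i)) =
        (ContinuousLinearMap.pi fun i : Fin 2 ↦
          (![fderiv ℂ (t₁ ∘ φ.symm) y, fderiv ℂ (t₂ ∘ φ.symm) y] i)).comp
          (mfderiv 𝓘(ℂ, E) 𝓘(ℂ, E) φ (φ.symm y)) := by
      rw [ContinuousLinearMap.pi_comp]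
      congr 1
      funext i
      fin_cases i
      · exact e₁
      · exact e₂
    rw [epi] at hs
    exact Function.Surjective.of_comp (g := (mfderiv 𝓘(ℂ, E) 𝓘(ℂ, E) φ (φ.symm y) : E → E)) hs
  have hfZ' : ∀ y ∈ C, (t₁ ∘ φ.symm) y = 0 → (t₂ ∘ φ.symm) y = 0 → (f ∘ φ.symm) y = 0 :=
    fun y hy h1 h2 ↦ hfZ _ (hsymm y hy) h1 h2
  obtain ⟨g₀, h₀, hg₀, hh₀, hfgh⟩ := exists_eq_mul_add_mul_of_forall_eq_zero hE hCo hCc (hrd ht₁)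
    (hrd ht₂) (hrd hf) hd₁' hd₁₂' hfZ'
  have hpull : ∀ {q : E → ℂ}, DifferentiableOn ℂ q C →
      MDifferentiableOn 𝓘(ℂ, E) 𝓘(ℂ, ℂ) (fun x ↦ q (φ x)) W := fun {q} hq x hx ↦ by
    have hxs : x ∈ (chartAt E x₀).source := by
      rw [← extChartAt_source 𝓘(ℂ, E)]; exact hWs hx
    have h1 : MDifferentiableAt 𝓘(ℂ, E) 𝓘(ℂ, ℂ) q (φ x) :=
      mdifferentiableAt_iff_differentiableAt.2 (hq.differentiableAt (hCo.mem_nhds (hφW x hx)))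
    exact (h1.comp x (mdifferentiableAt_extChartAt hxs)).mdifferentiableWithinAt
  refine ⟨fun x ↦ g₀ (φ x), fun x ↦ h₀ (φ x), hpull hg₀, hpull hh₀, fun x hx ↦ ?_⟩
  have h1 := hfgh (φ x) (hφW x hx)
  simp only [Function.comp_apply, φ.left_inv (hWs hx)] at h1
  exact h1

end Literature.Geometry.Kaehler

end
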